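import Literature.MathematicalPhysics.QuantumFieldTheory.Balaban1983to89.B12Eq213Body268

/-!
# `Balaban1983to89.B12Eq213GaussianTiltedMoments` — T. Bałaban, *Renormalization group approach to lattice gauge field
theories. I*, Commun. Math. Phys. **109** (1987) 249–301 [Balaban1987RG1], (2.12)–(2.13) p. 268 (the Gaussian fluctuation
integral); T. Bałaban, *… II. Cluster expansions*, Commun. Math. Phys. **116** (1988) 1–22 [Balaban1988RG2Cluster], (2.20) p. 16
and (2.23)–(2.25) p. 17: **TILTED GAUSSIAN MOMENTS of the (2.13) body at its Gaussian datum of record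
(`B12Eq213Body268.FluctData.gaussian`, measures `gaussProb (prec U)`) under a (2.20)-type quadratic domination of the exponent —
`∫dμ_{M⁻¹} e^{½c|B|²} = √(det M ∕ det(M − c))`, two-sided size of *«the integral above»*, and the tilted exponential ∕ polynomial
moments that the seat's cut-off and last-coupling bounds display, kernel-checked**

statement-level skeleton of published theorems with citation tags; proofs where landed; nothing here is a claim about
the Yang–Mills mass gap

PDF held: `paper:balaban1987-cmp109-rg-i-small-field` (journal page = PDF page + 248), `paper:balaban1988-cmp116-rg-ii-cluster`
(journal page = PDF page); (2.20), (2.23)–(2.25) pp. 16–17 of [II] through the tree's certified readings (`B13Integral223`,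
`B13.indicator_le_exp_222`), (2.12)–(2.13) p. 268 of [I] re-read this session.

CITATION HEADER / WHAT IS REPRODUCED (cell `pub-ymgap`, HUMAN RULING D-0062 Track A, seat `pub-ymgap-dag-n22-b` = the
FIRST-MISSING-ESTIMATE seat of DAG node N22 = NE9; fourth module of the body-level chain (dag-lead [DAGLEAD-G0-REBALANCE-5] (2));
a NEW LEAF over r20's `B12Eq213Body268` (§4 `FluctData.gaussian`, `integral_gaussian_eq`; `B2Eq228Conditioning.gaussProb`,
`gaussNorm_eq`; `B13GaugeDevices.gaussWeight ∕ gaussNorm ∕ gaussMean`), nothing there modified).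

THE PRINT.  [I] p. 268 [PDF 20]: *«the measure becomes a Gaussian measure in variables B, with the covariance C^{(k)} =
C^{(k)}(U_{k+1}) = (C*Δ^{(k)}C)⁻¹»* and (2.13) `𝐄^{(k+1)}(g_k, U_{k+1}) = log ∫dμ_{C^{(k)}}(B) χ_k exp[𝐏^{(k)}(g_k, U_{k+1}, B) + {…}]`.
[II] p. 16 (2.20): *«Σ_{Y∈𝐃}|τ(Y)||V_k(Y,B)| ≤ ½Σ_{b,b′⊂Y₀}α₄M⁻⁴e^{−(1/16)(κ₁−1)M⁻¹|b−b′|}|B(b)||B(b′)| + Σ_{…}»* — the exponent of the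
fluctuation integral is dominated by a QUADRATIC FORM in `B` with small constants (plus constants); p. 17 (2.25): *«∫dμ₀(X)|_Z
exp ½O(α₅)‖ZX‖² = Π_{b∈Z}(1 − O(α₅))^{−½d(𝔤)} ≤ exp(O(α₅)|Z|)»* — the Gaussian integral of the exponential of a small quadratic form.
Print applies these to the LOCALIZED (2.14) terms inside the cluster expansion; the application below is to the un-localised (2.13)
body — the same Gaussian mechanism, NOT print's statement.

WHAT THIS MODULE DOES (THEOREMS ONLY; no definition, no named fact):
* §1 (Gaussian algebra over `gaussProb M`, `M` positive definite on finitely many real coordinates): `gaussWeight_mul_exp_sq` (the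
  weight of `M` times `e^{½c|x|²}` is the weight of `M − c·1`), **`integral_exp_sq_gaussProb`** (`∫ e^{½c|B|²} dμ_{M⁻¹} =
  √(det M)∕√(det(M − c·1))` for `M − c·1` positive definite — the (2.25) identity at a general precision; print's `(1 − a)^{−½·|N|}` is
  the case `M = 1`, cf. `B13Integral223.outer_225_eq`), `gaussMean_mono_general`, `sq_le_exp_sq` (`|B|² ≤ (2∕δ)e^{½δ|B|²}`).
* §2 (the (2.13) body at its Gaussian datum `FluctData.gaussian prec hpd χ h0 h1 𝐏 {…}`, `M = prec U`, under the (2.20)-TYPE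
  DOMINATION `|𝐏^{(k)} + {…}| ≤ a₀ + ½α|B|²` on the support of `χ_U`): **`integral_gaussian_le_of_quadDom`** (*«the integral above»*
  `≤ e^{a₀}√(det M∕det(M − α))`), **`integral_gaussian_ge_of_quadDom`** (`≥ e^{−a₀}·∫ χ_U e^{−½α|B|²} dμ_{M⁻¹}`, the damped small-field
  mass), **`tiltedExpMoment_le_of_quadDom`** (for a bond variable with `ℓ(B)² ≤ |B|²` and `γ ≥ 0`:
  `∫ χ_U e^{𝐏+{…}} e^{½γℓ²} dμ ≤ e^{a₀}√(det M∕det(M − (α+γ)))` — the numerator of the seat's cut-off channel bound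
  `B12Eq213CutoffDependence.newTerm_sub_newTerm_le_largeField` made EFFECTIVE), **`tiltedQuadMoment_le_of_quadDom`** (for a majorant
  `m₀ + ½m₂|B|²` of `|∂_g(𝐏+{…})|`: `∫ χ_U e^{𝐏+{…}}·(m₀ + ½m₂|B|²) dμ ≤ e^{a₀}(m₀√(det M∕det(M−α)) + (m₂∕δ)√(det M∕det(M−(α+δ))))` —
  the numerator of the seat's `B12Eq213CouplingDependence` v1.1 tilted-expectation bound of `∂_g 𝐄^{(k+1)}` made EFFECTIVE).
HONEST READING: body-level Gaussian bookkeeping; what makes `a₀, α, m₀, m₂` Bałaban's is (2.12)'s explicit `𝐏^{(k)}` + [II] Lemma 2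
(1.41)–(1.43) ⇒ (2.20) (node N10's territory) and the object W1; the small-field mass in the lower bound is left as an integral.

WHAT IS *NOT* HERE: linear sources `⟨J, B⟩` in the exponent ((2.23)–(2.24), tree: `B13Integral223.innerB_*`); the determinant
quotient estimate `√(det M∕det(M−c)) ≤ e^{c·tr(M⁻¹)}`-type ((2.17), tree: `B13PerturbativeStep`); localization.  Every theorem is
elementary Gaussian calculus about the typed body; the `[cite: …]` tags locate the printed objects and displays.  HONEST FRAMING:
count-neutral Track-A side module; NOT a discharge of node N22; one finite T⁴ programme at fixed ε, Bałaban AS PRINTED with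
locators; nothing continuum ∕ ℝ⁴ ∕ OS ∕ mass-gap ∕ Clay.
-/

noncomputable section

namespace Literature.MathematicalPhysics.QuantumFieldTheory.Balaban1983to89.B12Eq213GaussianTiltedMoments

open _root_.MeasureTheory Matrix
open scoped BigOperators
open Literature.MathematicalPhysics.QuantumFieldTheory.Balaban1983to89
open Literature.MathematicalPhysics.QuantumFieldTheory.Balaban1983to89.B12Eq213Body268 (FluctData)
open Literature.MathematicalPhysics.QuantumFieldTheory.Balaban1983to89.B13GaugeDevices (gaussWeight gaussNorm gaussMean gaussInt)
open Literature.MathematicalPhysics.QuantumFieldTheory.Balaban1983to89.B2Eq228Conditioning (gaussProb gaussNorm_eq gaussNorm_pos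
  integral_gaussProb_eq integrable_gaussWeight)

/-! ## §1. Gaussian algebra: the weight of `M` tilted by `e^{½c|x|²}` is the weight of `M − c·1` -/

section Gaussian

variable {κ : Type} [Fintype κ] [DecidableEq κ]

/-- `e^{−½⟨x, Mx⟩}·e^{½c⟨x, x⟩} = e^{−½⟨x, (M − c·1)x⟩}`. [cite: Balaban1988RG2Cluster, (2.25) p.17] -/
theorem gaussWeight_mul_exp_sq (M : Matrix κ κ ℝ) (c : ℝ) (x : κ → ℝ) :
    gaussWeight M x * Real.exp (c / 2 * (x ⬝ᵥ x)) = gaussWeight (M - c • (1 : Matrix κ κ ℝ)) x := by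
  rw [gaussWeight, gaussWeight, ← Real.exp_add]
  congr 1
  rw [sub_mulVec, smul_mulVec, one_mulVec, dotProduct_sub, dotProduct_smul, smul_eq_mul]
  ring

/-- `∫dx e^{−½⟨x, Mx⟩} e^{½c|x|²} = gaussNorm (M − c·1)` (no hypothesis: both sides are the same integral). [cite: Balaban1988RG2Cluster, (2.25) p.17] -/
theorem integral_gaussWeight_mul_exp_sq (M : Matrix κ κ ℝ) (c : ℝ) :
    ∫ x, gaussWeight M x * Real.exp (c / 2 * (x ⬝ᵥ x)) = gaussNorm (M - c • (1 : Matrix κ κ ℝ)) := by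
  rw [gaussNorm]
  exact integral_congr_ae (Filter.Eventually.of_forall fun x => gaussWeight_mul_exp_sq M c x)

/-- **(2.25) AT A GENERAL PRECISION**: for `M` and `M − c·1` positive definite,
`∫ e^{½c|B|²} dμ_{M⁻¹}(B) = √(det M) ∕ √(det (M − c·1))` (print's `Π(1 − a)^{−½}` is the case `M = 1`, tree
`B13Integral223.outer_225_eq`). [cite: Balaban1988RG2Cluster, (2.25) p.17] -/
theorem integral_exp_sq_gaussProb {M : Matrix κ κ ℝ} (hM : M.PosDef) {c : ℝ}
    (hMc : (M - c • (1 : Matrix κ κ ℝ)).PosDef) :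
    ∫ B, Real.exp (c / 2 * (B ⬝ᵥ B)) ∂(gaussProb M) = Real.sqrt M.det / Real.sqrt (M - c • (1 : Matrix κ κ ℝ)).det := by
  rw [integral_gaussProb_eq, integral_gaussWeight_mul_exp_sq, gaussNorm_eq hM, gaussNorm_eq hMc]
  have hπ : 0 < Real.sqrt (2 * Real.pi) ^ Fintype.card κ := pow_pos (Real.sqrt_pos.2 (by positivity)) _
  have h1 : 0 < Real.sqrt M.det := Real.sqrt_pos.2 hM.det_pos
  have h2 : 0 < Real.sqrt (M - c • (1 : Matrix κ κ ℝ)).det := Real.sqrt_pos.2 hMc.det_pos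
  field_simp

omit [DecidableEq κ] in
/-- Monotonicity of the normalised Gaussian mean of `M` for a non-negative minorant under a majorant integrable against the
weight (the `M = 1` case is `B13Integral223.gaussMean_one_mono`). [cite: Balaban1988RG2Cluster, (2.25) p.17] -/
theorem gaussMean_mono_general (M : Matrix κ κ ℝ) {f g : (κ → ℝ) → ℝ} (hf0 : ∀ x, 0 ≤ f x) (hfg : ∀ x, f x ≤ g x)
    (hg : Integrable (fun x => gaussWeight M x * g x)) : gaussMean M f ≤ gaussMean M g := by
  rw [gaussMean, gaussMean, gaussInt, gaussInt, smul_eq_mul, smul_eq_mul]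
  refine mul_le_mul_of_nonneg_left ?_ (inv_nonneg.2 (B2Eq228Conditioning.gaussNorm_nonneg _))
  simp_rw [smul_eq_mul]
  refine integral_mono_of_nonneg (Filter.Eventually.of_forall fun x => ?_) hg
    (Filter.Eventually.of_forall fun x => ?_)
  · exact mul_nonneg (Real.exp_pos _).le (hf0 x)
  · exact mul_le_mul_of_nonneg_left (hfg x) (Real.exp_pos _).le

omit [DecidableEq κ] in
/-- Constants come out of a normalised Gaussian mean (any precision; plumbing). [folklore] -/
private theorem gaussMean_const_mul' (M : Matrix κ κ ℝ) (k : ℝ) (f : (κ → ℝ) → ℝ) :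
    gaussMean M (fun x => k * f x) = k * gaussMean M f := by
  rw [gaussMean, gaussMean, gaussInt, gaussInt, smul_eq_mul, smul_eq_mul]
  simp_rw [smul_eq_mul, mul_left_comm _ k, integral_const_mul]
  ring

omit [DecidableEq κ] in
/-- `|B|² ≤ (2∕δ)·e^{½δ|B|²}` for `δ > 0` (from `1 + t ≤ e^{t}`): polynomial moments reduce to exponential ones. [folklore] -/
private theorem sq_le_exp_sq {δ : ℝ} (hδ : 0 < δ) (x : κ → ℝ) :
    x ⬝ᵥ x ≤ 2 / δ * Real.exp (δ / 2 * (x ⬝ᵥ x)) := by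
  have h := Real.add_one_le_exp (δ / 2 * (x ⬝ᵥ x))
  have hx : 0 ≤ x ⬝ᵥ x := Finset.sum_nonneg fun i _ => mul_self_nonneg (x i)
  rw [div_mul_eq_mul_div, le_div_iff₀ hδ]
  nlinarith

end Gaussian

/-! ## §2. The (2.13) body at its Gaussian datum under a (2.20)-type quadratic domination -/

section Body

variable {X : Type*} {κ : Type} [Fintype κ] [DecidableEq κ]
variable (prec : X → Matrix κ κ ℝ) (hpd : ∀ U, (prec U).PosDef) (χ : X → (κ → ℝ) → ℝ) (h0 : ∀ U B, 0 ≤ χ U B)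
  (h1 : ∀ U B, χ U B ≤ 1) (P Q : ℝ → X → (κ → ℝ) → ℝ)

/-- *«The integral above»* at the Gaussian datum IS a normalised Gaussian mean:
`∫ χ_U e^{𝐏+{…}} dμ_{C^{(k)}(U)} = gaussMean (prec U) (χ_U e^{𝐏+{…}})`. [cite: Balaban1987RG1, (2.12)–(2.13) p.268] -/
theorem integral_gaussian_eq_gaussMean (g : ℝ) (U : X) :
    (FluctData.gaussian prec hpd χ h0 h1 P Q).integral g U
      = gaussMean (prec U) (fun B => χ U B * Real.exp (P g U B + Q g U B)) := by
  rw [FluctData.integral_gaussian_eq, gaussMean, gaussInt, smul_eq_mul]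
  simp_rw [smul_eq_mul]

/-- **UPPER BOUND OF THE (2.13) INTEGRAL UNDER QUADRATIC DOMINATION**: if `|𝐏^{(k)} + {…}| ≤ a₀ + ½α|B|²` on the support of
`χ_U` and `M − α·1` is positive definite (`M = prec U`), then `∫ χ_U e^{𝐏+{…}} dμ_{M⁻¹} ≤ e^{a₀}·√(det M)∕√(det(M − α·1))`.
[cite: Balaban1988RG2Cluster, (2.20) p.16 and (2.25) p.17; Balaban1987RG1, (2.13) p.268] -/
theorem integral_gaussian_le_of_quadDom {g : ℝ} {U : X} {a₀ α : ℝ}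
    (hdom : ∀ B, χ U B ≠ 0 → |P g U B + Q g U B| ≤ a₀ + α / 2 * (B ⬝ᵥ B))
    (hMα : (prec U - α • (1 : Matrix κ κ ℝ)).PosDef) :
    (FluctData.gaussian prec hpd χ h0 h1 P Q).integral g U
      ≤ Real.exp a₀ * (Real.sqrt (prec U).det / Real.sqrt (prec U - α • (1 : Matrix κ κ ℝ)).det) := by
  have step : gaussMean (prec U) (fun B => χ U B * Real.exp (P g U B + Q g U B))
      ≤ gaussMean (prec U) (fun B => Real.exp a₀ * Real.exp (α / 2 * (B ⬝ᵥ B))) := by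
    refine gaussMean_mono_general (prec U) (fun B => mul_nonneg (h0 U B) (Real.exp_nonneg _)) (fun B => ?_) ?_
    · by_cases hχ : χ U B = 0
      · rw [hχ, zero_mul]; positivity
      · have hb := (abs_le.1 (hdom B hχ)).2
        calc χ U B * Real.exp (P g U B + Q g U B) ≤ 1 * Real.exp (a₀ + α / 2 * (B ⬝ᵥ B)) :=
              mul_le_mul (h1 U B) (Real.exp_le_exp.2 hb) (Real.exp_nonneg _) zero_le_one
          _ = Real.exp a₀ * Real.exp (α / 2 * (B ⬝ᵥ B)) := by rw [one_mul, Real.exp_add]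
    · have h := (integrable_gaussWeight hMα).const_mul (Real.exp a₀)
      refine h.congr (Filter.Eventually.of_forall fun B => ?_)
      simp only [← gaussWeight_mul_exp_sq]
      ring
  calc (FluctData.gaussian prec hpd χ h0 h1 P Q).integral g U
      = gaussMean (prec U) (fun B => χ U B * Real.exp (P g U B + Q g U B)) :=
        integral_gaussian_eq_gaussMean prec hpd χ h0 h1 P Q g U
    _ ≤ gaussMean (prec U) (fun B => Real.exp a₀ * Real.exp (α / 2 * (B ⬝ᵥ B))) := step
    _ = Real.exp a₀ * gaussMean (prec U) (fun B => Real.exp (α / 2 * (B ⬝ᵥ B))) := gaussMean_const_mul' _ _ _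
    _ = Real.exp a₀ * (Real.sqrt (prec U).det / Real.sqrt (prec U - α • (1 : Matrix κ κ ℝ)).det) := by
        rw [← B2Eq228Conditioning.integral_gaussProb, integral_exp_sq_gaussProb (hpd U) hMα]

/-- **LOWER BOUND OF THE (2.13) INTEGRAL UNDER QUADRATIC DOMINATION**: under the same domination,
`∫ χ_U e^{𝐏+{…}} dμ_{M⁻¹} ≥ e^{−a₀}·∫ χ_U e^{−½α|B|²} dμ_{M⁻¹}` — the DAMPED SMALL-FIELD MASS (the integrand integrable against the
weight). [cite: Balaban1988RG2Cluster, (2.20) p.16; Balaban1987RG1, (2.13) p.268] -/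
theorem integral_gaussian_ge_of_quadDom {g : ℝ} {U : X} {a₀ α : ℝ}
    (hdom : ∀ B, χ U B ≠ 0 → |P g U B + Q g U B| ≤ a₀ + α / 2 * (B ⬝ᵥ B))
    (hint : Integrable (fun B => gaussWeight (prec U) B * (χ U B * Real.exp (P g U B + Q g U B)))) :
    Real.exp (-a₀) * ∫ B, χ U B * Real.exp (-(α / 2 * (B ⬝ᵥ B))) ∂(gaussProb (prec U))
      ≤ (FluctData.gaussian prec hpd χ h0 h1 P Q).integral g U := by
  have step : gaussMean (prec U) (fun B => Real.exp (-a₀) * (χ U B * Real.exp (-(α / 2 * (B ⬝ᵥ B)))))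
      ≤ gaussMean (prec U) (fun B => χ U B * Real.exp (P g U B + Q g U B)) := by
    refine gaussMean_mono_general (prec U)
      (fun B => mul_nonneg (Real.exp_nonneg _) (mul_nonneg (h0 U B) (Real.exp_nonneg _))) (fun B => ?_) hint
    by_cases hχ : χ U B = 0
    · simp [hχ]
    · have hb := (abs_le.1 (hdom B hχ)).1
      calc Real.exp (-a₀) * (χ U B * Real.exp (-(α / 2 * (B ⬝ᵥ B))))
          = χ U B * Real.exp (-a₀ + -(α / 2 * (B ⬝ᵥ B))) := by rw [Real.exp_add]; ring
        _ ≤ χ U B * Real.exp (P g U B + Q g U B) :=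
            mul_le_mul_of_nonneg_left (Real.exp_le_exp.2 (by linarith)) (h0 U B)
  calc Real.exp (-a₀) * ∫ B, χ U B * Real.exp (-(α / 2 * (B ⬝ᵥ B))) ∂(gaussProb (prec U))
      = Real.exp (-a₀) * gaussMean (prec U) (fun B => χ U B * Real.exp (-(α / 2 * (B ⬝ᵥ B)))) := by
        rw [B2Eq228Conditioning.integral_gaussProb]
    _ = gaussMean (prec U) (fun B => Real.exp (-a₀) * (χ U B * Real.exp (-(α / 2 * (B ⬝ᵥ B))))) :=
        (gaussMean_const_mul' _ _ _).symm
    _ ≤ gaussMean (prec U) (fun B => χ U B * Real.exp (P g U B + Q g U B)) := step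
    _ = (FluctData.gaussian prec hpd χ h0 h1 P Q).integral g U :=
        (integral_gaussian_eq_gaussMean prec hpd χ h0 h1 P Q g U).symm

include hpd in
/-- **TILTED EXPONENTIAL MOMENT** (the numerator of the seat's cut-off channel bound
`B12Eq213CutoffDependence.newTerm_sub_newTerm_le_largeField`, made effective): for a bond variable `ℓ` with `ℓ(B)² ≤ |B|²`, `γ ≥ 0`,
the domination `|𝐏+{…}| ≤ a₀ + ½α|B|²` on the support of a window `χ′_U ∈ [0, 1]` and `M − (α+γ)·1` positive definite:
`∫ χ′_U e^{𝐏+{…}} e^{½γℓ²} dμ_{M⁻¹} ≤ e^{a₀}·√(det M)∕√(det(M − (α+γ)·1))`. [cite: Balaban1988RG2Cluster, (2.20)–(2.22) p.16 and (2.25) p.17] -/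
theorem tiltedExpMoment_le_of_quadDom {g : ℝ} {U : X} {a₀ α γ : ℝ} (hγ : 0 ≤ γ) (ℓ : (κ → ℝ) → ℝ)
    (hℓ : ∀ B, ℓ B ^ 2 ≤ B ⬝ᵥ B) (χ' : X → (κ → ℝ) → ℝ) (h0' : ∀ U B, 0 ≤ χ' U B) (h1' : ∀ U B, χ' U B ≤ 1)
    (hdom : ∀ B, χ' U B ≠ 0 → |P g U B + Q g U B| ≤ a₀ + α / 2 * (B ⬝ᵥ B))
    (hM : (prec U - (α + γ) • (1 : Matrix κ κ ℝ)).PosDef) :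
    ∫ B, χ' U B * Real.exp (P g U B + Q g U B) * Real.exp (γ / 2 * (ℓ B) ^ 2) ∂(gaussProb (prec U))
      ≤ Real.exp a₀ * (Real.sqrt (prec U).det / Real.sqrt (prec U - (α + γ) • (1 : Matrix κ κ ℝ)).det) := by
  have hmaj : Integrable (fun B => gaussWeight (prec U) B * (Real.exp a₀ * Real.exp ((α + γ) / 2 * (B ⬝ᵥ B)))) := by
    have h := (integrable_gaussWeight hM).const_mul (Real.exp a₀)
    refine h.congr (Filter.Eventually.of_forall fun B => ?_)
    simp only [← gaussWeight_mul_exp_sq]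
    ring
  have step : gaussMean (prec U) (fun B => χ' U B * Real.exp (P g U B + Q g U B) * Real.exp (γ / 2 * (ℓ B) ^ 2))
      ≤ gaussMean (prec U) (fun B => Real.exp a₀ * Real.exp ((α + γ) / 2 * (B ⬝ᵥ B))) := by
    refine gaussMean_mono_general (prec U)
      (fun B => mul_nonneg (mul_nonneg (h0' U B) (Real.exp_nonneg _)) (Real.exp_nonneg _)) (fun B => ?_) hmaj
    by_cases hχ : χ' U B = 0
    · rw [hχ, zero_mul, zero_mul]; positivity
    · have hb := (abs_le.1 (hdom B hχ)).2
      have hl : γ / 2 * (ℓ B) ^ 2 ≤ γ / 2 * (B ⬝ᵥ B) := mul_le_mul_of_nonneg_left (hℓ B) (by linarith)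
      calc χ' U B * Real.exp (P g U B + Q g U B) * Real.exp (γ / 2 * (ℓ B) ^ 2)
          ≤ 1 * Real.exp (a₀ + α / 2 * (B ⬝ᵥ B)) * Real.exp (γ / 2 * (B ⬝ᵥ B)) :=
            mul_le_mul (mul_le_mul (h1' U B) (Real.exp_le_exp.2 hb) (Real.exp_nonneg _) zero_le_one)
              (Real.exp_le_exp.2 hl) (Real.exp_nonneg _) (mul_nonneg zero_le_one (Real.exp_nonneg _))
        _ = Real.exp a₀ * Real.exp ((α + γ) / 2 * (B ⬝ᵥ B)) := by
            rw [one_mul, ← Real.exp_add, ← Real.exp_add]; ring_nf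
  calc ∫ B, χ' U B * Real.exp (P g U B + Q g U B) * Real.exp (γ / 2 * (ℓ B) ^ 2) ∂(gaussProb (prec U))
      = gaussMean (prec U) (fun B => χ' U B * Real.exp (P g U B + Q g U B) * Real.exp (γ / 2 * (ℓ B) ^ 2)) :=
        B2Eq228Conditioning.integral_gaussProb _ _
    _ ≤ gaussMean (prec U) (fun B => Real.exp a₀ * Real.exp ((α + γ) / 2 * (B ⬝ᵥ B))) := step
    _ = Real.exp a₀ * gaussMean (prec U) (fun B => Real.exp ((α + γ) / 2 * (B ⬝ᵥ B))) := gaussMean_const_mul' _ _ _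
    _ = Real.exp a₀ * (Real.sqrt (prec U).det / Real.sqrt (prec U - (α + γ) • (1 : Matrix κ κ ℝ)).det) := by
        rw [← B2Eq228Conditioning.integral_gaussProb, integral_exp_sq_gaussProb (hpd U) hM]

include hpd h0 h1 in
/-- **TILTED QUADRATIC MOMENT** (the numerator of the seat's tilted-expectation bound of `∂_g 𝐄^{(k+1)}`,
`B12Eq213CouplingDependence` v1.1 `abs_deriv_newTerm_le_tilted`, made effective): for a majorant `m₀ + ½m₂|B|²` (`m₀, m₂ ≥ 0`) under the
domination `|𝐏+{…}| ≤ a₀ + ½α|B|²` on the support of `χ_U`, any `δ > 0` with `M − α·1` and `M − (α+δ)·1` positive definite: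
`∫ χ_U e^{𝐏+{…}}·(m₀ + ½m₂|B|²) dμ_{M⁻¹} ≤ e^{a₀}·(m₀·√(det M∕det(M − α·1)) + (m₂∕δ)·√(det M∕det(M − (α+δ)·1)))`.
[cite: Balaban1988RG2Cluster, (2.20) p.16 and (2.25) p.17; Balaban1987RG1, (2.13) p.268 and p.263 (clause before (1.18))] -/
theorem tiltedQuadMoment_le_of_quadDom {g : ℝ} {U : X} {a₀ α δ m₀ m₂ : ℝ} (hm₀ : 0 ≤ m₀) (hm₂ : 0 ≤ m₂) (hδ : 0 < δ)
    (hdom : ∀ B, χ U B ≠ 0 → |P g U B + Q g U B| ≤ a₀ + α / 2 * (B ⬝ᵥ B))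
    (hMα : (prec U - α • (1 : Matrix κ κ ℝ)).PosDef) (hMδ : (prec U - (α + δ) • (1 : Matrix κ κ ℝ)).PosDef) :
    ∫ B, χ U B * Real.exp (P g U B + Q g U B) * (m₀ + m₂ / 2 * (B ⬝ᵥ B)) ∂(gaussProb (prec U))
      ≤ Real.exp a₀ * (m₀ * (Real.sqrt (prec U).det / Real.sqrt (prec U - α • (1 : Matrix κ κ ℝ)).det)
          + m₂ / δ * (Real.sqrt (prec U).det / Real.sqrt (prec U - (α + δ) • (1 : Matrix κ κ ℝ)).det)) := by
  -- the two exponential moments, as integrals against dμ_{M⁻¹}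
  rw [← integral_exp_sq_gaussProb (hpd U) hMα, ← integral_exp_sq_gaussProb (hpd U) hMδ]
  rw [integral_gaussProb_eq, integral_gaussProb_eq, integral_gaussProb_eq]
  -- everything is `(gaussNorm M)⁻¹ · ∫ gaussWeight M · (…)`; compare the integrands pointwise
  have hN : 0 ≤ (gaussNorm (prec U))⁻¹ := inv_nonneg.2 (B2Eq228Conditioning.gaussNorm_nonneg _)
  have hI1 : Integrable (fun B => gaussWeight (prec U) B * Real.exp (α / 2 * (B ⬝ᵥ B))) := by
    refine (integrable_gaussWeight hMα).congr (Filter.Eventually.of_forall fun B => ?_)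
    simp only [← gaussWeight_mul_exp_sq]
  have hI2 : Integrable (fun B => gaussWeight (prec U) B * Real.exp ((α + δ) / 2 * (B ⬝ᵥ B))) := by
    refine (integrable_gaussWeight hMδ).congr (Filter.Eventually.of_forall fun B => ?_)
    simp only [← gaussWeight_mul_exp_sq]
  have hmaj : Integrable (fun B => gaussWeight (prec U) B *
      (Real.exp a₀ * (m₀ * Real.exp (α / 2 * (B ⬝ᵥ B)) + m₂ / δ * Real.exp ((α + δ) / 2 * (B ⬝ᵥ B))))) := by
    have h := ((hI1.const_mul m₀).add (hI2.const_mul (m₂ / δ))).const_mul (Real.exp a₀)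
    refine h.congr (Filter.Eventually.of_forall fun B => ?_)
    simp only [Pi.add_apply]
    ring
  have hpt : ∀ B, gaussWeight (prec U) B * (χ U B * Real.exp (P g U B + Q g U B) * (m₀ + m₂ / 2 * (B ⬝ᵥ B)))
      ≤ gaussWeight (prec U) B *
        (Real.exp a₀ * (m₀ * Real.exp (α / 2 * (B ⬝ᵥ B)) + m₂ / δ * Real.exp ((α + δ) / 2 * (B ⬝ᵥ B)))) := by
    intro B
    refine mul_le_mul_of_nonneg_left ?_ (Real.exp_pos _).le
    have hx : 0 ≤ B ⬝ᵥ B := Finset.sum_nonneg fun i _ => mul_self_nonneg (B i)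
    by_cases hχ : χ U B = 0
    · rw [hχ, zero_mul, zero_mul]; positivity
    · have hb := (abs_le.1 (hdom B hχ)).2
      have hw : χ U B * Real.exp (P g U B + Q g U B) ≤ Real.exp a₀ * Real.exp (α / 2 * (B ⬝ᵥ B)) := by
        calc χ U B * Real.exp (P g U B + Q g U B) ≤ 1 * Real.exp (a₀ + α / 2 * (B ⬝ᵥ B)) :=
              mul_le_mul (h1 U B) (Real.exp_le_exp.2 hb) (Real.exp_nonneg _) zero_le_one
          _ = Real.exp a₀ * Real.exp (α / 2 * (B ⬝ᵥ B)) := by rw [one_mul, Real.exp_add]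
      have hsq := sq_le_exp_sq hδ B
      have hm : m₀ + m₂ / 2 * (B ⬝ᵥ B) ≤ m₀ + m₂ / 2 * (2 / δ * Real.exp (δ / 2 * (B ⬝ᵥ B))) := by
        nlinarith
      have hw0 : 0 ≤ χ U B * Real.exp (P g U B + Q g U B) := mul_nonneg (h0 U B) (Real.exp_nonneg _)
      calc χ U B * Real.exp (P g U B + Q g U B) * (m₀ + m₂ / 2 * (B ⬝ᵥ B))
          ≤ (Real.exp a₀ * Real.exp (α / 2 * (B ⬝ᵥ B))) * (m₀ + m₂ / 2 * (2 / δ * Real.exp (δ / 2 * (B ⬝ᵥ B)))) :=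
            mul_le_mul hw hm (by positivity) (by positivity)
        _ = Real.exp a₀ * (m₀ * Real.exp (α / 2 * (B ⬝ᵥ B)) + m₂ / δ * Real.exp ((α + δ) / 2 * (B ⬝ᵥ B))) := by
            have e : Real.exp ((α + δ) / 2 * (B ⬝ᵥ B)) = Real.exp (α / 2 * (B ⬝ᵥ B)) * Real.exp (δ / 2 * (B ⬝ᵥ B)) := by
              rw [← Real.exp_add]; ring_nf
            rw [e]
            ring
  have hmono : ∫ B, gaussWeight (prec U) B * (χ U B * Real.exp (P g U B + Q g U B) * (m₀ + m₂ / 2 * (B ⬝ᵥ B)))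
      ≤ ∫ B, gaussWeight (prec U) B *
        (Real.exp a₀ * (m₀ * Real.exp (α / 2 * (B ⬝ᵥ B)) + m₂ / δ * Real.exp ((α + δ) / 2 * (B ⬝ᵥ B)))) := by
    refine integral_mono_of_nonneg (Filter.Eventually.of_forall fun B => ?_) hmaj (Filter.Eventually.of_forall hpt)
    have hx : 0 ≤ B ⬝ᵥ B := Finset.sum_nonneg fun i _ => mul_self_nonneg (B i)
    exact mul_nonneg (Real.exp_pos _).le (mul_nonneg (mul_nonneg (h0 U B) (Real.exp_nonneg _)) (by positivity))
  have hsplit : ∫ B, gaussWeight (prec U) B *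
        (Real.exp a₀ * (m₀ * Real.exp (α / 2 * (B ⬝ᵥ B)) + m₂ / δ * Real.exp ((α + δ) / 2 * (B ⬝ᵥ B))))
      = Real.exp a₀ * (m₀ * (∫ B, gaussWeight (prec U) B * Real.exp (α / 2 * (B ⬝ᵥ B)))
          + m₂ / δ * (∫ B, gaussWeight (prec U) B * Real.exp ((α + δ) / 2 * (B ⬝ᵥ B)))) := by
    rw [← integral_const_mul, ← integral_const_mul, ← integral_add (hI1.const_mul _) (hI2.const_mul _),
      ← integral_const_mul]
    refine integral_congr_ae (Filter.Eventually.of_forall fun B => ?_)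
    ring
  rw [hsplit] at hmono
  calc (gaussNorm (prec U))⁻¹ *
        ∫ B, gaussWeight (prec U) B * (χ U B * Real.exp (P g U B + Q g U B) * (m₀ + m₂ / 2 * (B ⬝ᵥ B)))
      ≤ (gaussNorm (prec U))⁻¹ * (Real.exp a₀ * (m₀ * (∫ B, gaussWeight (prec U) B * Real.exp (α / 2 * (B ⬝ᵥ B)))
          + m₂ / δ * (∫ B, gaussWeight (prec U) B * Real.exp ((α + δ) / 2 * (B ⬝ᵥ B))))) :=
        mul_le_mul_of_nonneg_left hmono hN
    _ = Real.exp a₀ * (m₀ * ((gaussNorm (prec U))⁻¹ * ∫ B, gaussWeight (prec U) B * Real.exp (α / 2 * (B ⬝ᵥ B)))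
          + m₂ / δ * ((gaussNorm (prec U))⁻¹ * ∫ B, gaussWeight (prec U) B * Real.exp ((α + δ) / 2 * (B ⬝ᵥ B)))) := by
        ring

end Body

end Literature.MathematicalPhysics.QuantumFieldTheory.Balaban1983to89.B12Eq213GaussianTiltedMoments
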